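import Mathlib.NumberTheory.ArithmeticFunction.Moebius
import Mathlib.Analysis.SpecialFunctions.Pow.Real
import HarnessLib

/-!
# Numerical lemmas for the Chebotarev–Linnik theorem for Frobenius divisions

Topic `Summits/QuantumAdvantage/QuantumAdvantage/Theorems`, cell B2b-1 (linnik-cubic), PART A (gen 9);
helper toward the crux `DegreeOnePrimesEscape` (stmt-QuantumAdvantage-11543) of route
`LinnikCubicClassGroups`.  HONEST FRAMING: the value of this file is a THEOREM (elementary bookkeeping) —
NOT summit progress.

* `sum_moebius_div_mul_ge_of_termwise` — from termwise bounds `Main_d − Err ≤ T_d` (when `μ(d) = 1`) and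
  `T_d ≤ Main_d + Err` (when `μ(d) = −1`) to
  `Σ_{d ∣ m} (μ(d)/d) T_d ≥ Σ_{d ∣ m} (μ(d)/d) Main_d − #divisors · Err`;
* `sum_moebius_div_ite_even_eq_neg` — for EVEN `m`: `Σ_{d ∣ m, d even} μ(d)/d = − Σ_{d ∣ m} μ(d)/d`
  (pair the odd divisor `d'` with `2d'`: `μ(2d')/(2d') = −μ(d')/(2d')`; divisors `4 ∣ d` have `μ(d) = 0`,
  cf. `Literature.NumberTheory.LFunctions.Green2012.moebius_eq_zero_of_four_dvd`)
  — the value of the exceptional term of the division count when `σ` acts non-trivially on the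
  quadratic field of the exceptional zero;
* `mul_rpow_three_quarters_le` — `B x^{3/4} ≤ x` once `B⁴ ≤ x`.
-/

noncomputable section

open scoped ArithmeticFunction.Moebius
open Finset Real

namespace Summit.QuantumAdvantage.QuantumAdvantage.Theorems.DegreeOnePrimesEscape

/-! ### From termwise bounds to the Möbius sum -/

/-- **Termwise to sum**: if `Main_d − Err ≤ T_d` whenever `μ(d) = 1` and `T_d ≤ Main_d + Err` whenever
`μ(d) = −1` (`d ∣ m`, `Err ≥ 0`), then
`Σ_{d ∣ m} (μ(d)/d) Main_d − #(divisors m) · Err ≤ Σ_{d ∣ m} (μ(d)/d) T_d`. -/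
theorem sum_moebius_div_mul_ge_of_termwise (m : ℕ) (T Main : ℕ → ℝ) {Err : ℝ} (hErr : 0 ≤ Err)
    (hlow : ∀ d ∈ m.divisors, ArithmeticFunction.moebius d = 1 → Main d - Err ≤ T d)
    (hup : ∀ d ∈ m.divisors, ArithmeticFunction.moebius d = -1 → T d ≤ Main d + Err) :
    ∑ d ∈ m.divisors, (ArithmeticFunction.moebius d : ℝ) / d * Main d - m.divisors.card * Err ≤
      ∑ d ∈ m.divisors, (ArithmeticFunction.moebius d : ℝ) / d * T d := by
  have hterm : ∀ d ∈ m.divisors, (ArithmeticFunction.moebius d : ℝ) / d * Main d - Err ≤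
      (ArithmeticFunction.moebius d : ℝ) / d * T d := by
    intro d hd
    have hd1 : (1 : ℝ) ≤ d := by exact_mod_cast Nat.pos_of_mem_divisors hd
    have hd0 : (0 : ℝ) < d := by linarith
    have hdinv : (1 : ℝ) / d ≤ 1 := by rw [div_le_one hd0]; exact hd1
    have hdinv0 : (0 : ℝ) ≤ 1 / d := by positivity
    rcases ArithmeticFunction.moebius_eq_or d with h0 | h1 | h1
    · rw [h0]; simp; exact hErr
    · have h := hlow d hd h1
      rw [h1]; push_cast
      have : (1 : ℝ) / d * (Main d - Err) ≤ 1 / d * T d := mul_le_mul_of_nonneg_left h hdinv0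
      have e1 : (1 : ℝ) / d * (Main d - Err) = 1 / d * Main d - 1 / d * Err := by ring
      have : 1 / d * Err ≤ Err := by nlinarith
      linarith
    · have h := hup d hd h1
      rw [h1]; push_cast
      have : (1 : ℝ) / d * T d ≤ 1 / d * (Main d + Err) := mul_le_mul_of_nonneg_left h hdinv0
      have e1 : (1 : ℝ) / d * (Main d + Err) = 1 / d * Main d + 1 / d * Err := by ring
      have : 1 / d * Err ≤ Err := by nlinarith
      have e2 : (-1 : ℝ) / d * Main d = -(1 / d * Main d) := by ring
      have e3 : (-1 : ℝ) / d * T d = -(1 / d * T d) := by ring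
      linarith
  have h := Finset.sum_le_sum hterm
  rw [Finset.sum_sub_distrib, Finset.sum_const, nsmul_eq_mul] at h
  linarith

/-! ### The even divisors -/

/-- `μ(2 d') = −μ(d')` for odd `d'`. -/
theorem moebius_two_mul_of_odd {d : ℕ} (hd : Odd d) :
    ArithmeticFunction.moebius (2 * d) = -ArithmeticFunction.moebius d := by
  have hcop : Nat.Coprime 2 d := Nat.coprime_two_left.mpr hd
  rw [ArithmeticFunction.isMultiplicative_moebius.map_mul_of_coprime hcop,
    ArithmeticFunction.moebius_apply_prime Nat.prime_two]
  ring

/-- **The even divisors**: for even `m ≠ 0`,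
`Σ_{d ∣ m} (μ(d)/d)·𝟙[d even] = −(1/2) Σ_{d ∣ m} (μ(d)/d)·𝟙[d odd]`. -/
theorem sum_moebius_div_ite_even_eq (m : ℕ) (hm : 2 ∣ m) (hm0 : m ≠ 0) :
    ∑ d ∈ m.divisors, (ArithmeticFunction.moebius d : ℝ) / d * (if Even d then 1 else 0) =
      -(1 / 2) * ∑ d ∈ m.divisors, (ArithmeticFunction.moebius d : ℝ) / d * (if Odd d then 1 else 0) := by
  classical
  -- the odd divisors `O` and their doubles `T = 2·O`
  set O : Finset ℕ := m.divisors.filter Odd with hO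
  set T : Finset ℕ := O.image (fun d => 2 * d) with hT
  have hTsub : T ⊆ m.divisors.filter Even := by
    intro d hd
    rw [hT, Finset.mem_image] at hd
    obtain ⟨d', hd', rfl⟩ := hd
    rw [hO, Finset.mem_filter, Nat.mem_divisors] at hd'
    rw [Finset.mem_filter, Nat.mem_divisors]
    refine ⟨⟨?_, hm0⟩, even_two_mul d'⟩
    exact Nat.Coprime.mul_dvd_of_dvd_of_dvd (Nat.coprime_two_left.mpr hd'.2) hm hd'.1.1
  -- left side: restrict to the even divisors, then to `T` (the others have `4 ∣ d`, `μ = 0`)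
  have hL : ∑ d ∈ m.divisors, (ArithmeticFunction.moebius d : ℝ) / d * (if Even d then 1 else 0) =
      ∑ d ∈ T, (ArithmeticFunction.moebius d : ℝ) / d := by
    rw [← Finset.sum_filter_of_ne (p := Even) (fun d _ h => by
      by_contra hne; rw [if_neg hne, mul_zero] at h; exact h rfl)]
    rw [Finset.sum_congr rfl (fun d hd => by
      rw [if_pos (Finset.mem_filter.mp hd).2, mul_one])]
    symm
    apply Finset.sum_subset hTsub
    intro d hd hdT
    rw [Finset.mem_filter, Nat.mem_divisors] at hd
    obtain ⟨⟨hdm, -⟩, heven⟩ := hd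
    -- `d` even, not twice an odd divisor ⇒ `4 ∣ d`
    have h4 : 4 ∣ d := by
      obtain ⟨k, hk⟩ := heven
      have hk2 : d = 2 * k := by omega
      by_cases hko : Odd k
      · exfalso
        apply hdT
        rw [hT, Finset.mem_image]
        refine ⟨k, ?_, hk2.symm⟩
        rw [hO, Finset.mem_filter, Nat.mem_divisors]
        exact ⟨⟨(Dvd.intro_left 2 hk2.symm).trans hdm, hm0⟩, hko⟩
      · rw [Nat.not_odd_iff_even] at hko
        obtain ⟨j, hj⟩ := hko
        exact ⟨j, by omega⟩
    have hμ0 : ArithmeticFunction.moebius d = 0 := by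
      apply ArithmeticFunction.moebius_eq_zero_of_not_squarefree
      intro hsq
      have h := hsq 2 (by obtain ⟨k, rfl⟩ := h4; exact ⟨k, by ring⟩)
      exact absurd (Nat.isUnit_iff.mp h) (by norm_num)
    rw [hμ0, Int.cast_zero, zero_div]
  -- `Σ_{d ∈ T} μ(d)/d = Σ_{d' ∈ O} μ(2d')/(2d') = −(1/2) Σ_{d' ∈ O} μ(d')/d'`
  have hinj : Set.InjOn (fun d : ℕ => 2 * d) O := fun a _ b _ h => by simpa using h
  have hTsum : ∑ d ∈ T, (ArithmeticFunction.moebius d : ℝ) / d =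
      ∑ d ∈ O, (ArithmeticFunction.moebius (2 * d) : ℝ) / (2 * d : ℕ) := by
    rw [hT, Finset.sum_image hinj]
  have hR : ∑ d ∈ m.divisors, (ArithmeticFunction.moebius d : ℝ) / d * (if Odd d then 1 else 0) =
      ∑ d ∈ O, (ArithmeticFunction.moebius d : ℝ) / d := by
    rw [hO, Finset.sum_filter]
    exact Finset.sum_congr rfl fun d _ => by split_ifs <;> simp
  rw [hL, hTsum, hR, Finset.mul_sum]
  refine Finset.sum_congr rfl fun d hd => ?_
  have hodd : Odd d := (Finset.mem_filter.mp (hO ▸ hd)).2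
  rw [moebius_two_mul_of_odd hodd]
  push_cast
  ring

/-- **The exceptional term of the division count for `σ ∉ K₁`**: for even `m ≠ 0`,
`Σ_{d ∣ m} (μ(d)/d)·𝟙[d even] = − Σ_{d ∣ m} μ(d)/d`. -/
theorem sum_moebius_div_ite_even_eq_neg (m : ℕ) (hm : 2 ∣ m) (hm0 : m ≠ 0) :
    ∑ d ∈ m.divisors, (ArithmeticFunction.moebius d : ℝ) / d * (if Even d then 1 else 0) =
      -∑ d ∈ m.divisors, (ArithmeticFunction.moebius d : ℝ) / d := by
  have hE := sum_moebius_div_ite_even_eq m hm hm0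
  have hsplit : ∑ d ∈ m.divisors, (ArithmeticFunction.moebius d : ℝ) / d =
      ∑ d ∈ m.divisors, (ArithmeticFunction.moebius d : ℝ) / d * (if Even d then 1 else 0) +
      ∑ d ∈ m.divisors, (ArithmeticFunction.moebius d : ℝ) / d * (if Odd d then 1 else 0) := by
    rw [← Finset.sum_add_distrib]
    refine Finset.sum_congr rfl fun d _ => ?_
    rcases Nat.even_or_odd d with h | h
    · rw [if_pos h, if_neg (Nat.not_odd_iff_even.mpr h)]; ring
    · rw [if_neg (Nat.not_even_iff_odd.mpr h), if_pos h]; ring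
  linarith

/-! ### Powers -/

/-- `B · x^{3/4} ≤ x` once `B⁴ ≤ x` (`B ≥ 0`, `x > 0`). -/
theorem mul_rpow_three_quarters_le {B x : ℝ} (hB : 0 ≤ B) (hx : 0 < x) (h : B ^ 4 ≤ x) :
    B * x ^ (3 / 4 : ℝ) ≤ x := by
  have h1 : B ≤ x ^ (1 / 4 : ℝ) := by
    have := Real.rpow_le_rpow (by positivity) h (by norm_num : (0 : ℝ) ≤ 1 / 4)
    rwa [← Real.rpow_natCast, ← Real.rpow_mul hB, show ((4 : ℕ) : ℝ) * (1 / 4 : ℝ) = 1 by norm_num,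
      Real.rpow_one] at this
  calc B * x ^ (3 / 4 : ℝ) ≤ x ^ (1 / 4 : ℝ) * x ^ (3 / 4 : ℝ) :=
        mul_le_mul_of_nonneg_right h1 (Real.rpow_nonneg hx.le _)
    _ = x := by rw [← Real.rpow_add hx]; norm_num

end Summit.QuantumAdvantage.QuantumAdvantage.Theorems.DegreeOnePrimesEscape

end
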